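import Summits.RiemannHypothesis.RiemannHypothesis.Theorems.Splittings.RobinFiniteLowHeightLaw
import HarnessLib

/-!
# RobinFiniteLowHeightRanges — gen 11 low-height CA law, part 4/4 (F–H): tolerances, thresholds, historical heights, all n

* F per-level tail tolerances `tolK` (1 `def`, definition lane), `robinCA_below_cells` (levels `≤ K` ⟹ `robinCA_below (4^{K+1})`),
  `tailH_le_of_height` (`tailH(T) ≤ n/(πT₀)` for `T ≥ T₀ ≥ 10⁵`, `T₀ ≤ e^n`), and the thresholds
  `RH(330 000) → 4¹⁴`, `RH(500 000) → 4¹⁵`, `RH(860 000) ⊇ RH(10⁶) → 4¹⁶`, `RH(1 620 000) → 4¹⁷`, `RH(3 000 000) → 4¹⁸`;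
* G `RH(545 439 823)` (van de Lune–te Riele–Winter 1986) `→ robinCA_below (3.3·10¹³ + 1)`;
  `RH(30 610 046 000)` (Platt 2017, rigorous) `→ robinCA_below (10¹⁷ + 1)`;
* H `θ(x) ≥ 0.99947 x` for `x ≥ 2²⁴` from the two print facts alone, the parameter bridge `robin_all_of_robinCA_below_low`, and
  the all-integer rows `RH(10⁶) ⟹ Robin for 5040 < n ≤ 10^(10⁹)`, `RH(545 439 823) ⟹ n ≤ 10^(1.4·10¹³)` (Morrill–Platt 2021
  enumerate to `10^(10^13.11485)`), `RH(30 610 046 000) ⟹ n ≤ 10^(4·10¹⁶)`.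

HONEST LABEL: SPLITTING SEARCH over kernel-typed RH-EQUIVALENCES; a splitting A ∧ B ⟹ RH is CONDITIONAL
bookkeeping unless A and B are both proved; nothing here bears on the truth of RH.
-/

set_option linter.dupNamespace false

noncomputable section

open Real Filter Finset
open scoped Chebyshev

namespace Summit.RiemannHypothesis.RiemannHypothesis.Theorems.Splittings.RobinFiniteC1

open Literature.NumberTheory.LFunctions Literature.NumberTheory.DiophantineGeometry
open RobinAnalyticSharp RobinAnalyticSharp.Cells
open Summit.RiemannHypothesis.RiemannHypothesis.Theorems.Splittings.RobinFiniteE3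

section LowHeight

/-! ### F · user-facing forms: per-level tolerances, cells-only ranges, height thresholds -/

/-- Per-level tail tolerances (the exact margins `(b_k − 0.0463)/((1 + 2/L1 k)·2^{k+1})` rounded down):
level `k` passes as soon as `tailH(T) ≤ tol k`. -/
def tolK : ℕ → ℚ
  | 11 => 1266 / 10 ^ 8 | 12 => 1892 / 10 ^ 8 | 13 => 1393 / 10 ^ 8 | 14 => 8955 / 10 ^ 9
  | 15 => 5201 / 10 ^ 9 | 16 => 2965 / 10 ^ 9 | 17 => 1595 / 10 ^ 9 | _ => 0

/-- The level condition from the tolerance. -/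
theorem level_of_tol {t : ℝ} {k : ℕ} (hk11 : 11 ≤ k) (hk17 : k ≤ 17) (ht : t ≤ ((tolK k : ℚ) : ℝ)) :
    0.0463 + (1 + 2 / ((L1 k : ℚ) : ℝ)) * (t * 2 ^ (k + 1)) ≤ ((bk k : ℚ) : ℝ) := by
  interval_cases k <;>
    · simp only [tolK, bk, L1, l2] at ht ⊢; push_cast at ht ⊢; norm_num at ht ⊢; nlinarith [ht]

/-- **Cells-only range at height `T`**: if every level `11 ≤ k ≤ K` (`K ≤ 17`) has `tailH(T) ≤ tol k`, then Robin holds at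
every CA number `> 5040` with primes `< 4^{K+1}` (the ramps are not reached). -/
theorem robinCA_below_cells (h16 : Buthe2016_thm2) (hB : Buthe2018_thm2_theta)
    (hK : BroadbentEtAl2021_theta_rel_1e19) {T : ℝ} (hT : 100000 ≤ T) (hRH : RiemannHypothesisUpTo T)
    {K : ℕ} (hK11 : 11 ≤ K) (hK17 : K ≤ 17)
    (htol : ∀ k : ℕ, 11 ≤ k → k ≤ K →
      (Real.log (T / (2 * π)) + 1) / (π * T) + (184 + 30 * Real.log T) / T ^ 2 ≤ ((tolK k : ℚ) : ℝ)) :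
    robinCA_below (4 ^ (K + 1)) := by
  have h1 : 1 ≤ 4 ^ (K + 1) := Nat.one_le_pow _ _ (by norm_num)
  rw [← Nat.sub_add_cancel h1]
  set X : ℕ := 4 ^ (K + 1) - 1 with hX_def
  have hXr : (X : ℝ) = (4 : ℝ) ^ (K + 1) - 1 := by
    rw [hX_def, Nat.cast_sub h1]; push_cast; ring
  have hX18 : (X : ℝ) < (4 : ℝ) ^ 18 := by
    rw [hXr]; have : (4 : ℝ) ^ (K + 1) ≤ 4 ^ 18 := pow_le_pow_right₀ (by norm_num) (by omega); linarith
  refine robinCA_below_low h16 hB hK hT hRH (X := X) ?_ ?_ ?_ ?_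
  · intro k hk11 hk17 hkX
    have hkK : k ≤ K := by
      by_contra h
      push Not at h
      have : (4 : ℝ) ^ (K + 1) ≤ 4 ^ k := pow_le_pow_right₀ (by norm_num) (by omega)
      rw [hXr] at hkX; linarith
    exact level_of_tol hk11 hk17 (htol k hk11 hkK)
  · intro h; exfalso; linarith
  · intro h; exfalso; have : (4 : ℝ) ^ 18 ≤ (10 : ℝ) ^ 14 := by norm_num
    linarith
  · intro h; exfalso; have : (4 : ℝ) ^ 18 ≤ 2 * (10 : ℝ) ^ 19 := by norm_num
    linarith

/-- **The tail price from the height**: `tailH(T) ≤ n/(π T₀)` for `T ≥ T₀ ≥ 10⁵` with `T₀ ≤ e^n` (`log T/T` is antitone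
beyond `e`; the tree's `RobinFiniteE1c.tailPrice_le_log_div`). -/
theorem tailH_le_of_height {T₀ T : ℝ} {n : ℕ} (hT₀ : 100000 ≤ T₀) (hn : T₀ ≤ 2.7182818283 ^ n) (hT : T₀ ≤ T) :
    (Real.log (T / (2 * π)) + 1) / (π * T) + (184 + 30 * Real.log T) / T ^ 2 ≤ n / (π * T₀) := by
  have hT5 : 100000 ≤ T := hT₀.trans hT
  have hT₀0 : 0 < T₀ := by linarith
  have he : Real.exp 1 ≤ T₀ := le_trans (le_trans Real.exp_one_lt_d9.le (by norm_num)) hT₀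
  have h1 : Real.log T / T ≤ Real.log T₀ / T₀ := Real.log_div_self_antitoneOn he (he.trans hT) hT
  have h2 : Real.log T₀ ≤ n := by
    rw [Real.log_le_iff_le_exp hT₀0]
    calc T₀ ≤ 2.7182818283 ^ n := hn
      _ ≤ (Real.exp 1) ^ n := pow_le_pow_left₀ (by norm_num) Real.exp_one_gt_d9.le n
      _ = Real.exp n := by rw [← Real.exp_nat_mul, mul_one]
  have h3 := RobinFiniteE1c.tailPrice_le_log_div hT5
  have e1 : Real.log T / (π * T) = (Real.log T / T) / π := by rw [div_div, mul_comm]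
  have e2 : (n : ℝ) / (π * T₀) = ((n : ℝ) / T₀) / π := by rw [div_div, mul_comm]
  rw [e1] at h3; rw [e2]
  exact h3.trans (div_le_div_of_nonneg_right (h1.trans (div_le_div_of_nonneg_right h2 hT₀0.le)) Real.pi_pos.le)

/-- **RH to height `330 000` ⟹ Robin at every CA number `> 5040` with primes `< 4¹⁴ = 268 435 456`**
(levels `11–13`; `tailH ≤ 13/(π·330000) = 1.254·10⁻⁵`).  The unconditional kernel range is `< 4¹¹`. -/
theorem robinCA_below_of_rh330000 (h16 : Buthe2016_thm2) (hB : Buthe2018_thm2_theta)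
    (hK : BroadbentEtAl2021_theta_rel_1e19) {T : ℝ} (hT : 330000 ≤ T) (hRH : RiemannHypothesisUpTo T) :
    robinCA_below (4 ^ 14) := by
  have hπ := Real.pi_gt_d6
  refine robinCA_below_cells h16 hB hK (by linarith) hRH (K := 13) (by norm_num) (by norm_num) fun k hk11 hk13 => ?_
  refine (tailH_le_of_height (n := 13) (by norm_num) (by norm_num) hT).trans ?_
  rw [div_le_iff₀ (by positivity)]
  interval_cases k <;> · simp only [tolK]; push_cast; nlinarith

/-- **RH to height `500 000` ⟹ Robin at CA numbers with primes `< 4¹⁵ ≈ 1.07·10⁹`** (`tailH ≤ 14/(π·500000)`). -/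
theorem robinCA_below_of_rh500000 (h16 : Buthe2016_thm2) (hB : Buthe2018_thm2_theta)
    (hK : BroadbentEtAl2021_theta_rel_1e19) {T : ℝ} (hT : 500000 ≤ T) (hRH : RiemannHypothesisUpTo T) :
    robinCA_below (4 ^ 15) := by
  have hπ := Real.pi_gt_d6
  refine robinCA_below_cells h16 hB hK (by linarith) hRH (K := 14) (by norm_num) (by norm_num) fun k hk11 hk13 => ?_
  refine (tailH_le_of_height (n := 14) (by norm_num) (by norm_num) hT).trans ?_
  rw [div_le_iff₀ (by positivity)]
  interval_cases k <;> · simp only [tolK]; push_cast; nlinarith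

/-- **RH to height `860 000` — in particular RH to height `10⁶`, the next tree certificate — ⟹ Robin at CA numbers with primes
`< 4¹⁶ ≈ 4.29·10⁹`** (`tailH ≤ 14/(π·860000)`). -/
theorem robinCA_below_of_rh860000 (h16 : Buthe2016_thm2) (hB : Buthe2018_thm2_theta)
    (hK : BroadbentEtAl2021_theta_rel_1e19) {T : ℝ} (hT : 860000 ≤ T) (hRH : RiemannHypothesisUpTo T) :
    robinCA_below (4 ^ 16) := by
  have hπ := Real.pi_gt_d6
  refine robinCA_below_cells h16 hB hK (by linarith) hRH (K := 15) (by norm_num) (by norm_num) fun k hk11 hk13 => ?_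
  refine (tailH_le_of_height (n := 14) (by norm_num) (by norm_num) hT).trans ?_
  rw [div_le_iff₀ (by positivity)]
  interval_cases k <;> · simp only [tolK]; push_cast; nlinarith

/-- **RH to height `1 620 000` ⟹ Robin at CA numbers with primes `< 4¹⁷ ≈ 1.72·10¹⁰`** (`tailH ≤ 15/(π·1620000)`). -/
theorem robinCA_below_of_rh1620000 (h16 : Buthe2016_thm2) (hB : Buthe2018_thm2_theta)
    (hK : BroadbentEtAl2021_theta_rel_1e19) {T : ℝ} (hT : 1620000 ≤ T) (hRH : RiemannHypothesisUpTo T) :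
    robinCA_below (4 ^ 17) := by
  have hπ := Real.pi_gt_d6
  refine robinCA_below_cells h16 hB hK (by linarith) hRH (K := 16) (by norm_num) (by norm_num) fun k hk11 hk13 => ?_
  refine (tailH_le_of_height (n := 15) (by norm_num) (by norm_num) hT).trans ?_
  rw [div_le_iff₀ (by positivity)]
  interval_cases k <;> · simp only [tolK]; push_cast; nlinarith

/-- **RH to height `3 000 000` ⟹ Robin at CA numbers with primes `< 4¹⁸ ≈ 6.87·10¹⁰`** — ALL SEVEN certified levels
(`tailH ≤ 15/(π·3·10⁶) = 1.5916·10⁻⁶ ≤ tol 17 = 1.595·10⁻⁶`). -/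
theorem robinCA_below_of_rh3000000 (h16 : Buthe2016_thm2) (hB : Buthe2018_thm2_theta)
    (hK : BroadbentEtAl2021_theta_rel_1e19) {T : ℝ} (hT : 3000000 ≤ T) (hRH : RiemannHypothesisUpTo T) :
    robinCA_below (4 ^ 18) := by
  have hπ := Real.pi_gt_d6
  refine robinCA_below_cells h16 hB hK (by linarith) hRH (K := 17) (by norm_num) (by norm_num) fun k hk11 hk13 => ?_
  refine (tailH_le_of_height (n := 15) (by norm_num) (by norm_num) hT).trans ?_
  rw [div_le_iff₀ (by positivity)]
  interval_cases k <;> · simp only [tolK]; push_cast; nlinarith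


/-! ### G · two historical verification heights on the ramps -/

/-- **RH to the 1986 height `545 439 823` (van de Lune–te Riele–Winter: the first `1.5·10⁹` zeros) ⟹ Robin at every CA
number `> 5040` with primes `≤ 3.3·10¹³`** (ramp 1a: `tailH ≤ 21/(πT) = 1.2256·10⁻⁸`, `(1 + 2/24.95)·tailH·√(3.3·10¹³) ≤ 0.0761`). -/
theorem robinCA_below_of_rh1986 (h16 : Buthe2016_thm2) (hB : Buthe2018_thm2_theta)
    (hK : BroadbentEtAl2021_theta_rel_1e19) {T : ℝ} (hT : 545439823 ≤ T) (hRH : RiemannHypothesisUpTo T) :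
    robinCA_below (33 * 10 ^ 12 + 1) := by
  have hπ := Real.pi_gt_d6
  have hT5 : (100000 : ℝ) ≤ T := by linarith
  have hT7 : (7 : ℝ) ≤ T := by linarith
  have ht0 := Summit.RiemannHypothesis.RiemannHypothesis.Theorems.Splittings.RobinFiniteTail.tailH_nonneg hT7
  have ht := tailH_le_of_height (n := 21) (by norm_num) (by norm_num) hT
  have ht' : (Real.log (T / (2 * π)) + 1) / (π * T) + (184 + 30 * Real.log T) / T ^ 2 ≤ 21 / (3.141592 * 545439823) :=
    ht.trans (div_le_div_of_nonneg_left (by norm_num) (by positivity) (by nlinarith))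
  have hmain := robinCA_below_low h16 hB hK hT5 hRH (X := 33 * 10 ^ 12) ?_ ?_ ?_ ?_
  · exact hmain
  · intro k hk11 hk17 _
    refine level_of_tol hk11 hk17 (ht'.trans ?_)
    interval_cases k <;> · simp only [tolK]; push_cast; norm_num
  · intro _
    have hf : 1 + 2 / Real.log ((4 : ℝ) ^ 18) ≤ 1 + 2 / 24.95 := by
      have := log_four_pow_18_bounds.1
      have h : 2 / Real.log ((4 : ℝ) ^ 18) ≤ 2 / 24.95 := div_le_div_of_nonneg_left (by norm_num) (by norm_num) this
      linarith
    have hf0 : 0 ≤ 1 + 2 / Real.log ((4 : ℝ) ^ 18) := by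
      have := log_four_pow_18_bounds.1
      have : 0 ≤ 2 / Real.log ((4 : ℝ) ^ 18) := by positivity
      linarith
    have hs : √(min (((33 * 10 ^ 12 : ℕ)) : ℝ) ((10 : ℝ) ^ 14)) ≤ 5744563 := by
      refine (Real.sqrt_le_sqrt (min_le_left _ _)).trans ?_
      push_cast
      exact (sqrt_between (s := 0) (by norm_num) (by norm_num) (by norm_num)).2
    calc (1 + 2 / Real.log ((4 : ℝ) ^ 18)) *
          (((Real.log (T / (2 * π)) + 1) / (π * T) + (184 + 30 * Real.log T) / T ^ 2) * √(min (((33 * 10 ^ 12 : ℕ)) : ℝ) ((10 : ℝ) ^ 14)))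
          ≤ (1 + 2 / 24.95) * ((21 / (3.141592 * 545439823)) * 5744563) :=
          mul_le_mul hf (mul_le_mul ht' hs (Real.sqrt_nonneg _) (by norm_num)) (mul_nonneg ht0 (Real.sqrt_nonneg _)) (by norm_num)
      _ ≤ 0.0773 := by norm_num
  · intro h; exfalso; push_cast at h; norm_num at h
  · intro h; exfalso; push_cast at h; norm_num at h

/-- **RH to Platt's 2017 rigorous height `30 610 046 000` (`1.03·10¹¹` zeros, interval arithmetic) ⟹ Robin at every CA number
`> 5040` with primes `≤ 10¹⁷`** (ramp 1b: `tailH ≤ 25/(πT) = 2.6·10⁻¹⁰`, `(1 + 2/32.236)·tailH·√10¹⁷ ≤ 0.0874`). -/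
theorem robinCA_below_of_rhPlatt2017 (h16 : Buthe2016_thm2) (hB : Buthe2018_thm2_theta)
    (hK : BroadbentEtAl2021_theta_rel_1e19) {T : ℝ} (hT : 30610046000 ≤ T) (hRH : RiemannHypothesisUpTo T) :
    robinCA_below (10 ^ 17 + 1) := by
  have hπ := Real.pi_gt_d6
  have hT5 : (100000 : ℝ) ≤ T := by linarith
  have hT7 : (7 : ℝ) ≤ T := by linarith
  have ht0 := Summit.RiemannHypothesis.RiemannHypothesis.Theorems.Splittings.RobinFiniteTail.tailH_nonneg hT7
  have ht := tailH_le_of_height (n := 25) (by norm_num) (by norm_num) hT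
  have ht' : (Real.log (T / (2 * π)) + 1) / (π * T) + (184 + 30 * Real.log T) / T ^ 2 ≤ 25 / (3.141592 * 30610046000) :=
    ht.trans (div_le_div_of_nonneg_left (by norm_num) (by positivity) (by nlinarith))
  have hmain := robinCA_below_low h16 hB hK hT5 hRH (X := 10 ^ 17) ?_ ?_ ?_ ?_
  · exact hmain
  · intro k hk11 hk17 _
    refine level_of_tol hk11 hk17 (ht'.trans ?_)
    interval_cases k <;> · simp only [tolK]; push_cast; norm_num
  · intro _
    have hf : 1 + 2 / Real.log ((4 : ℝ) ^ 18) ≤ 1 + 2 / 24.95 := by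
      have := log_four_pow_18_bounds.1
      have h : 2 / Real.log ((4 : ℝ) ^ 18) ≤ 2 / 24.95 := div_le_div_of_nonneg_left (by norm_num) (by norm_num) this
      linarith
    have hs : √(min (((10 ^ 17 : ℕ)) : ℝ) ((10 : ℝ) ^ 14)) ≤ (10 : ℝ) ^ 7 := by
      refine (Real.sqrt_le_sqrt (min_le_right _ _)).trans ?_
      exact (sqrt_between (s := 0) (by norm_num) (by norm_num) (by norm_num)).2
    calc (1 + 2 / Real.log ((4 : ℝ) ^ 18)) *
          (((Real.log (T / (2 * π)) + 1) / (π * T) + (184 + 30 * Real.log T) / T ^ 2) * √(min (((10 ^ 17 : ℕ)) : ℝ) ((10 : ℝ) ^ 14)))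
          ≤ (1 + 2 / 24.95) * ((25 / (3.141592 * 30610046000)) * (10 : ℝ) ^ 7) :=
          mul_le_mul hf (mul_le_mul ht' hs (Real.sqrt_nonneg _) (by norm_num)) (mul_nonneg ht0 (Real.sqrt_nonneg _)) (by norm_num)
      _ ≤ 0.0773 := by norm_num
  · intro _
    have hf : 1 + 2 / Real.log ((10 : ℝ) ^ 14) ≤ 1 + 2 / 32.236 := by
      have := log_ten_pow_14_bounds.1
      have h : 2 / Real.log ((10 : ℝ) ^ 14) ≤ 2 / 32.236 := div_le_div_of_nonneg_left (by norm_num) (by norm_num) this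
      linarith
    have hs : √(min (((10 ^ 17 : ℕ)) : ℝ) (2 * (10 : ℝ) ^ 19)) ≤ 316227767 := by
      refine (Real.sqrt_le_sqrt (min_le_left _ _)).trans ?_
      push_cast
      exact (sqrt_between (s := 0) (by norm_num) (by norm_num) (by norm_num)).2
    calc (1 + 2 / Real.log ((10 : ℝ) ^ 14)) *
          (((Real.log (T / (2 * π)) + 1) / (π * T) + (184 + 30 * Real.log T) / T ^ 2) * √(min (((10 ^ 17 : ℕ)) : ℝ) (2 * (10 : ℝ) ^ 19)))
          ≤ (1 + 2 / 32.236) * ((25 / (3.141592 * 30610046000)) * 316227767) :=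
          mul_le_mul hf (mul_le_mul ht' hs (Real.sqrt_nonneg _) (by norm_num)) (mul_nonneg ht0 (Real.sqrt_nonneg _)) (by norm_num)
      _ ≤ 0.0904 := by norm_num
  · intro h; exfalso; push_cast at h; norm_num at h


/-! ### H · all-integer currency -/

/-- **`θ(x) ≥ 0.99947·x` for every `x ≥ 2²⁴`, unconditionally** (Büthe 2018 Thm 2: `x − θ(x) ≤ 1.95√x ≤ 0.00053·x` on
`[2²⁴, 10¹⁹]`; BKLNW 2021: `|θ(x) − x| < 3.79·10⁻⁵ x/log² x` beyond). -/
theorem theta_ge_99947_of_facts (hB : Buthe2018_thm2_theta) (hK : BroadbentEtAl2021_theta_rel_1e19) {x : ℝ}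
    (hx : (2 : ℝ) ^ 24 ≤ x) : 0.99947 * x ≤ θ x := by
  have hx0 : 0 < x := lt_of_lt_of_le (by norm_num) hx
  rcases le_or_gt x ((10 : ℝ) ^ 19) with h19 | h19
  · have h1 := hB.1 x (le_trans (by norm_num) hx) h19
    have hsx : √x * √x = x := Real.mul_self_sqrt hx0.le
    have hs0 : (4096 : ℝ) ≤ √x := by
      have : √((2 : ℝ) ^ 24) = 4096 := by
        rw [show ((2 : ℝ) ^ 24) = 4096 ^ 2 by norm_num, Real.sqrt_sq (by norm_num)]
      rw [← this]; exact Real.sqrt_le_sqrt hx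
    nlinarith [Real.sqrt_nonneg x]
  · have h1 := hK x h19.le
    have hlog : (43 : ℝ) ≤ Real.log x := by
      have h43 : (43 : ℝ) ≤ Real.log ((10 : ℝ) ^ 19) := by
        have h := (log_ten_pow_bounds 19).1
        have h' : ((19 : ℕ) : ℝ) * 2.3025850925 = 43.7491167575 := by norm_num
        rw [h'] at h
        exact le_trans (by norm_num) h
      exact h43.trans (Real.log_le_log (by norm_num) h19.le)
    have h2 : -(3.79e-5 / Real.log x ^ 2) < (θ x - x) / x := (abs_lt.1 h1).1
    have h3 : 3.79e-5 / Real.log x ^ 2 ≤ 3.79e-5 / 43 ^ 2 :=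
      div_le_div_of_nonneg_left (by norm_num) (by positivity) (pow_le_pow_left₀ (by norm_num) hlog 2)
    have h4 : -(0.00053 : ℝ) ≤ (θ x - x) / x := by
      have : (3.79e-5 : ℝ) / 43 ^ 2 ≤ 0.00053 := by norm_num
      linarith
    rw [le_div_iff₀ hx0] at h4
    linarith

/-- **The parameter bridge at range `X`** (gen 8's `robin_all_of_robinCA_below` with `B⋆ = X`, as in `robin_all_of_height`, the
`θ`-input now the unconditional `theta_ge_99947_of_facts`): `robinCA_below (X + 1)` for `X ≥ 2²⁴ + 1` gives Robin's inequality for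
every `5040 < n` with `log n ≤ 0.99947·(X − 1)`. -/
theorem robin_all_of_robinCA_below_low (hB : Buthe2018_thm2_theta) (hK : BroadbentEtAl2021_theta_rel_1e19)
    {X : ℕ} (hRB : robinCA_below (X + 1)) (hX : 2 ^ 24 + 1 ≤ X) :
    ∀ n : ℕ, 5040 < n → Real.log n ≤ 0.99947 * ((X : ℝ) - 1) → robinInequality n := by
  classical
  have hX1 : 1 ≤ X := le_trans (by norm_num) hX
  have hXR : ((2 : ℝ) ^ 24 + 1) ≤ (X : ℝ) := by exact_mod_cast hX
  have h24 : (2 : ℝ) ^ 24 ≤ (X : ℝ) - 1 := by linarith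
  have hW1 : 0.99947 * ((X : ℝ) - 1) ≤ θ ((X : ℝ) - 1) := theta_ge_99947_of_facts hB hK h24
  set ε : ℝ := Real.log (1 + 1 / (X : ℝ)) / Real.log (X : ℝ) with hε_def
  have hBs1 : (1 : ℝ) < (X : ℝ) := by linarith
  have hε : 0 < ε := by
    refine div_pos (Real.log_pos ?_) (Real.log_pos hBs1)
    have : (0 : ℝ) < 1 / (X : ℝ) := by positivity
    linarith
  obtain ⟨Ns, hNs1, hNs, -⟩ := Nat.exists_greatest_isCAParameter hε
  have hNs0 : Ns ≠ 0 := by omega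
  have hthr : ∀ r : ℕ, r.Prime → (r : ℝ) ^ ε ≤ 1 + 1 / r → r < X + 1 := by
    intro r hr hle
    by_contra hge
    push Not at hge
    have hr' : (X : ℝ) < r := by
      have : ((X + 1 : ℕ) : ℝ) ≤ r := by exact_mod_cast hge
      push_cast at this; linarith
    have := one_add_inv_lt_rpow hBs1 hr'
    rw [← hε_def] at this
    linarith
  have hdiv : ∀ p ∈ Nat.primesLE (X - 1), p ∣ Ns := by
    intro p hp
    obtain ⟨hple, hpp⟩ := Nat.mem_primesLE.1 hp
    refine dvd_of_rpow_lt hNs hNs0 hpp (rpow_lt_one_add_inv hBs1 (by exact_mod_cast hpp.one_lt) ?_)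
    have h1 : p < X := by omega
    exact_mod_cast h1
  have hprod : (∏ p ∈ Nat.primesLE (X - 1), p) ∣ Ns :=
    Finset.prod_primes_dvd Ns (fun p hp => (Nat.mem_primesLE.1 hp).2.prime) hdiv
  have hlogNs : 0.99947 * ((X : ℝ) - 1) ≤ Real.log Ns := by
    have hle : (∏ p ∈ Nat.primesLE (X - 1), p) ≤ Ns := Nat.le_of_dvd (by omega) hprod
    have hpos : ∀ p ∈ Nat.primesLE (X - 1), ((p : ℕ) : ℝ) ≠ 0 := fun p hp => by
      exact_mod_cast (Nat.mem_primesLE.1 hp).2.ne_zero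
    have h1 : Real.log ((∏ p ∈ Nat.primesLE (X - 1), p : ℕ) : ℝ) = θ (((X - 1 : ℕ)) : ℝ) := by
      rw [Chebyshev.theta_eq_sum_primesLE_log, Nat.cast_prod, Real.log_prod hpos]
    have hprodpos : (0 : ℝ) < ((∏ p ∈ Nat.primesLE (X - 1), p : ℕ) : ℝ) := by
      rw [Nat.cast_prod]; exact Finset.prod_pos fun p hp => by exact_mod_cast (Nat.mem_primesLE.1 hp).2.pos
    have h2 : Real.log ((∏ p ∈ Nat.primesLE (X - 1), p : ℕ) : ℝ) ≤ Real.log Ns :=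
      Real.log_le_log hprodpos (by exact_mod_cast hle)
    have hcast : (((X - 1 : ℕ)) : ℝ) = (X : ℝ) - 1 := Nat.cast_pred (by omega)
    rw [h1, hcast] at h2
    exact hW1.trans h2
  have hNs5040 : 5040 < Ns := by
    by_contra hle
    push Not at hle
    have h1 : (Ns : ℝ) ≤ 5040 := by exact_mod_cast hle
    have h2 : Real.log Ns ≤ Real.log 5040 := Real.log_le_log (by exact_mod_cast hNs1) h1
    have h3 : Real.log 5040 ≤ 5040 - 1 := Real.log_le_sub_one_of_pos (by norm_num)
    have h4 : (2 : ℝ) ^ 24 = 16777216 := by norm_num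
    rw [h4] at h24
    linarith
  intro n hn hlog
  refine robin_all_of_robinCA_below hRB hε hthr hNs hNs5040 n hn ?_
  by_contra hgt
  push Not at hgt
  have h3 : Real.log Ns < Real.log n :=
    Real.log_lt_log (by exact_mod_cast hNs1) (by exact_mod_cast hgt)
  linarith

/-- **RH to height `10⁶` ⟹ Robin's inequality for every `5040 < n ≤ 10^(10⁹)`** (cells to `4¹⁶`; `log n ≤ 10⁹ log 10 ≤
0.99947·(4¹⁶ − 2)`).  Unconditionally the tree has `n ≤ 10^(10^6.29)` (`robin_all_le` family); Briggs 2006 enumerated to `10^(10¹⁰)`. -/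
theorem robin_le_of_rh6 (h16 : Buthe2016_thm2) (hB : Buthe2018_thm2_theta)
    (hK : BroadbentEtAl2021_theta_rel_1e19) {T : ℝ} (hT : 1000000 ≤ T) (hRH : RiemannHypothesisUpTo T) :
    ∀ n : ℕ, 5040 < n → n ≤ 10 ^ 10 ^ 9 → robinInequality n := by
  have hRB : robinCA_below (4 ^ 16 - 1 + 1) := by
    rw [Nat.sub_add_cancel (Nat.one_le_pow _ _ (by norm_num))]
    exact robinCA_below_of_rh860000 h16 hB hK (by linarith) hRH
  intro n hn hle
  -- `hle` is consumed by the abstract bridge and CLEARED before any arithmetic tactic sees it: the power is never evaluated.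
  have hn0 : 0 < n := lt_of_le_of_lt (Nat.zero_le 5040) hn
  have h1 : Real.log n ≤ ((10 ^ 9 : ℕ) : ℝ) * Real.log 10 := log_le_of_le_ten_pow hn0 hle
  clear hle
  refine robin_all_of_robinCA_below_low hB hK hRB (by norm_num) n hn ?_
  have h10 := RobinAnalytic.log_ten_lt
  have hc : (((4 : ℕ) ^ 16 - 1 : ℕ) : ℝ) = (4 : ℝ) ^ 16 - 1 := by
    rw [Nat.cast_pred (by positivity)]; push_cast; ring
  rw [hc]
  have h9 : ((10 ^ 9 : ℕ) : ℝ) = 1e9 := by norm_num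
  rw [h9] at h1
  linarith

/-- **RH to the 1986 height `545 439 823` ⟹ Robin's inequality for every `5040 < n ≤ 10^(1.4·10¹³)`** — past the Morrill–Platt
2021 enumeration record `10^(10^13.114)` — (`robinCA_below_of_rh1986`, `log n ≤ 1.4·10¹³ log 10 ≤ 0.99947·(3.3·10¹³ − 1)`). -/
theorem robin_le_of_rh1986 (h16 : Buthe2016_thm2) (hB : Buthe2018_thm2_theta)
    (hK : BroadbentEtAl2021_theta_rel_1e19) {T : ℝ} (hT : 545439823 ≤ T) (hRH : RiemannHypothesisUpTo T) :
    ∀ n : ℕ, 5040 < n → n ≤ 10 ^ (14 * 10 ^ 12) → robinInequality n := by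
  have hRB := robinCA_below_of_rh1986 h16 hB hK hT hRH
  intro n hn hle
  have hn0 : 0 < n := lt_of_le_of_lt (Nat.zero_le 5040) hn
  have h1 : Real.log n ≤ ((14 * 10 ^ 12 : ℕ) : ℝ) * Real.log 10 := log_le_of_le_ten_pow hn0 hle
  clear hle
  refine robin_all_of_robinCA_below_low hB hK hRB (by norm_num) n hn ?_
  have h10 := RobinAnalytic.log_ten_lt
  have h9 : ((14 * 10 ^ 12 : ℕ) : ℝ) = 1.4e13 := by norm_num
  have hX : (((33 * 10 ^ 12 : ℕ)) : ℝ) = 3.3e13 := by norm_num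
  rw [h9] at h1
  rw [hX]
  linarith

/-- **RH to Platt's 2017 height `30 610 046 000` ⟹ Robin's inequality for every `5040 < n ≤ 10^(4·10¹⁶)`**
(`robinCA_below_of_rhPlatt2017`, `log n ≤ 4·10¹⁶ log 10 ≤ 0.99947·(10¹⁷ − 1)`). -/
theorem robin_le_of_rhPlatt2017 (h16 : Buthe2016_thm2) (hB : Buthe2018_thm2_theta)
    (hK : BroadbentEtAl2021_theta_rel_1e19) {T : ℝ} (hT : 30610046000 ≤ T) (hRH : RiemannHypothesisUpTo T) :
    ∀ n : ℕ, 5040 < n → n ≤ 10 ^ (4 * 10 ^ 16) → robinInequality n := by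
  have hRB := robinCA_below_of_rhPlatt2017 h16 hB hK hT hRH
  intro n hn hle
  have hn0 : 0 < n := lt_of_le_of_lt (Nat.zero_le 5040) hn
  have h1 : Real.log n ≤ ((4 * 10 ^ 16 : ℕ) : ℝ) * Real.log 10 := log_le_of_le_ten_pow hn0 hle
  clear hle
  refine robin_all_of_robinCA_below_low hB hK hRB (by norm_num) n hn ?_
  have h10 := RobinAnalytic.log_ten_lt
  have h9 : ((4 * 10 ^ 16 : ℕ) : ℝ) = 4e16 := by norm_num
  have hX : (((10 ^ 17 : ℕ)) : ℝ) = 1e17 := by norm_num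
  rw [h9] at h1
  rw [hX]
  linarith

end LowHeight

end Summit.RiemannHypothesis.RiemannHypothesis.Theorems.Splittings.RobinFiniteC1

end
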